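import Summits.ResolutionOfSingularities.ResolutionOfSingularities.Theorems.FrobeniusClosingPatchingRelPerfectDepthMultiHostCJSTransportPieceP
import HarnessLib

/-!
# Crux `PatchingRelPerfect` (stmt-ResolutionOfSingularities-16161), chain W5.2 — F7(β) (β-AX) T2b-X, module 2:
# the JOINT PIECES LOOP over one CJS centre

[OURS · L1 W5.2 · F7(β) (β-AX) T2b-X (res-L1-w52-plan-1 CORRECTION G11-15′ (2): hand res-D-pv-054 g7)] Fact-free; def-free; the
X-side LIFT is the hypothesis `hlift` of module 1′ (`…DepthMultiHostCJSTransportPiece`: integral Noetherian carriers, centres `C ≠ ⊥`); NOT statements of the manuscript under review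
(Hironaka 2017); AI-written, weaker than expert review.

* `piece_data_transport` — the data of a later (disjoint) piece survive the blowing up of the first piece (E-side).
* `joint_centre` — ONE CJS CENTRE: its pieces on the carrier are blown up one after the other by `joint_piece`, the CJS blowing up
  following through `exists_fac_of_isPiecePartition_cons`; when no piece is left the remaining blowing up is along `⊤`, an isomorphism
  `e : (new carrier) ≅ (CJS stage)` (ISO-TOLERANCE, as in R5ᴴ N3 `HSepCJS.cjs_transport`).  X-side: a blowing up along ONE ideal sheaf
  supported on the carrier (`IsBlowup.exists_isBlowup_comp_supported`), `X′` regular, `K′ = π^* K`.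

## References
* V. Cossart, U. Jannsen, S. Saito, LNM 2270 (2020), Thm. 1.4, (6.2), Def. 4.1. [CossartJannsenSaito2020]
* J. Kollár, *Lectures on Resolution of Singularities* (2007), (3.111) Steps 1–3. [Kollar2007]
* E. Bierstone, D. Grigoriev, P. Milman, J. Włodarczyk (2011), §4 Step 2b. [BierstoneGrigorievMilmanWlodarczyk2011]
* The Stacks Project, Tags 080A, 080B. [StacksProject]
-/

-- `Summit.<Summit>.<Sub>.Theorems` with `Sub = Summit` (single-conjunct summit, D-0017)
set_option linter.dupNamespace false

noncomputable section

open CategoryTheory CategoryTheory.Limits AlgebraicGeometry TopologicalSpace IsLocalRing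
open Literature.AlgebraicGeometry.Resolution Scheme.IdealSheafData
open Literature.AlgebraicGeometry.Hironaka2017.MonomialPart

namespace Summit.ResolutionOfSingularities.ResolutionOfSingularities.Theorems

universe u

namespace MultiHostCJS

open DepthMultiHost WeightTwoB

/-! ## §1 Transport of the data of a later piece -/

/-- **The data of a DISJOINT later piece survive the blowing up of the first piece**: irreducible, regular, snc with the new boundary
traces. [cite: Kollar2007, Def. 3.25] [cite: GortzWedhorn2020, Prop. 13.91 (3)] -/
theorem piece_data_transport {E E' : Scheme.{u}} [IsLocallyNoetherian E] {𝓑 : List E.IdealSheafData} {Z Z₂ : Closeds E}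
    {τ : E' ⟶ E} (hsnc : HasSNCWith 𝓑 (vanishingIdeal Z)) (hτ : IsBlowup τ (vanishingIdeal Z))
    (hirr₂ : IsIrreducible (Z₂ : Set E)) (hZ₂ : Scheme.IsRegular (vanishingIdeal Z₂).subscheme)
    (hsnc₂ : HasSNCWith 𝓑 (vanishingIdeal Z₂)) (hd : Disjoint (Z : Set E) Z₂) :
    IsIrreducible ((Z₂.preimage τ.continuous : Closeds E') : Set E') ∧
      Scheme.IsRegular (vanishingIdeal (Z₂.preimage τ.continuous : Closeds E')).subscheme ∧
      HasSNCWith (𝓑.map (strictTransformIdeal τ (vanishingIdeal Z)) ++ [(vanishingIdeal Z).comap τ])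
        (vanishingIdeal (Z₂.preimage τ.continuous)) := by
  haveI : IsLocallyNoetherian E' := hτ.isLocallyNoetherian
  have hd' : Disjoint (Z₂ : Set E) ((vanishingIdeal Z).support : Set E) := by
    rw [Scheme.IdealSheafData.coe_support_vanishingIdeal]; exact hd.symm
  have hdC : Disjoint ((vanishingIdeal Z).support : Set E) ((vanishingIdeal Z₂).support : Set E) := by
    rw [Scheme.IdealSheafData.coe_support_vanishingIdeal, Scheme.IdealSheafData.coe_support_vanishingIdeal]; exact hd
  refine ⟨hτ.isIrreducible_preimage_of_disjoint Z₂ hd' hirr₂, hτ.isRegular_subscheme_vanishingIdeal_preimage Z₂ hd' hZ₂, ?_⟩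
  have h := HasSNCWith.transform_comap_of_disjoint hτ hsnc hsnc₂ hdC
  rwa [hτ.comap_vanishingIdeal_of_disjoint Z₂ hd'] at h

/-! ## §2 ONE CJS CENTRE: the joint pieces loop -/

section Loop

variable (hlift : ∀ ⦃X X' : Scheme.{u}⦄ [IsNoetherian X] [IsLocallyNoetherian X'] (S : MultiHostState X)
    (cyl : CylState S) [IsIntegral cyl.Z] [IsNoetherian cyl.Z] (C : cyl.Z.IdealSheafData), C ≠ ⊥ →
    Scheme.IsRegular C.subscheme → C = vanishingIdeal C.support →
    ∀ (𝓑 : List cyl.Z.IdealSheafData), (∀ T ∈ S.𝓔, T ≠ cyl.j.ker → cyl.bd T ∈ 𝓑) → HasSNCWith 𝓑 C →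
    ∀ (τ : X' ⟶ X) (hτ : IsBlowup τ (vanishingIdeal (cyl.centre C))) (η : X), IsGenericPoint η (cyl.centre C : Set X) →
    ∀ (m : Fin S.n → ℕ), (∀ i, cyl.tr i ≤ C ^ m i) → ∀ (ν : ℕ), (∀ i, ν ≤ m i + weightAt (S.exps i) η) →
    ∃ (hsncX : HasSNCWith S.𝓔 (vanishingIdeal (cyl.centre C)))
      (cyl' : CylState (S.step τ (cyl.centre C) η m ν hsncX hτ)) (τZ : cyl'.Z ⟶ cyl.Z),
      IsBlowup τZ C ∧ cyl'.j ≫ τ = τZ ≫ cyl.j ∧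
      cyl'.j.ker = strictTransformIdeal τ (vanishingIdeal (cyl.centre C)) cyl.j.ker ∧
      (∀ i, cyl'.tr i = controlledTransform τZ C (cyl.tr i) (m i)) ∧
      (∀ T ∈ S.𝓔, T ≠ cyl.j.ker →
        cyl'.bd (strictTransformIdeal τ (vanishingIdeal (cyl.centre C)) T) = strictTransformIdeal τZ C (cyl.bd T)) ∧
      cyl'.bd ((vanishingIdeal (cyl.centre C)).comap τ) = C.comap τZ ∧
      ((cyl'.V : Set X') ⊆ τ ⁻¹' (cyl.V : Set X)))


variable (P : ∀ ⦃X : Scheme.{u}⦄ (S : MultiHostState X), CylState S → Prop)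
  (hP : ∀ ⦃X X' : Scheme.{u}⦄ [IsNoetherian X] [IsLocallyNoetherian X'] (S : MultiHostState X)
    (cyl : CylState S) [IsIntegral cyl.Z] [IsNoetherian cyl.Z] (C : cyl.Z.IdealSheafData), C ≠ ⊥ →
    Scheme.IsRegular C.subscheme → C = vanishingIdeal C.support →
    ∀ (𝓑 : List cyl.Z.IdealSheafData), (∀ T ∈ S.𝓔, T ≠ cyl.j.ker → cyl.bd T ∈ 𝓑) → HasSNCWith 𝓑 C →
    ∀ (τ : X' ⟶ X) (hτ : IsBlowup τ (vanishingIdeal (cyl.centre C))) (η : X), IsGenericPoint η (cyl.centre C : Set X) →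
    ∀ (m : Fin S.n → ℕ), (∀ i, cyl.tr i ≤ C ^ m i) → ∀ (ν : ℕ), (∀ i, ν ≤ m i + weightAt (S.exps i) η) →
    ∀ (hsncX : HasSNCWith S.𝓔 (vanishingIdeal (cyl.centre C)))
      (cyl' : CylState (S.step τ (cyl.centre C) η m ν hsncX hτ)) (τZ : cyl'.Z ⟶ cyl.Z),
      IsBlowup τZ C → cyl'.j ≫ τ = τZ ≫ cyl.j →
      cyl'.j.ker = strictTransformIdeal τ (vanishingIdeal (cyl.centre C)) cyl.j.ker →
      (∀ i, cyl'.tr i = controlledTransform τZ C (cyl.tr i) (m i)) →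
      (∀ T ∈ S.𝓔, T ≠ cyl.j.ker →
        cyl'.bd (strictTransformIdeal τ (vanishingIdeal (cyl.centre C)) T) = strictTransformIdeal τZ C (cyl.bd T)) →
      cyl'.bd ((vanishingIdeal (cyl.centre C)).comap τ) = C.comap τZ → ((cyl'.V : Set X') ⊆ τ ⁻¹' (cyl.V : Set X)) →
      P S cyl → P (S.step τ (cyl.centre C) η m ν hsncX hτ) cyl')

include hlift hP

/-- The loop behind `joint_centre`, by induction on the number of pieces (`[]` allowed: then the given blowing up is along `⊤`, an
isomorphism absorbed into `e`). [cite: BierstoneGrigorievMilmanWlodarczyk2011, §4 Step 2b] [cite: StacksProject, Tag 080A] -/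
theorem joint_centre_aux (n : ℕ) :
    ∀ {X : Scheme.{u}} [IsNoetherian X] (_hX : Scheme.IsRegular X) (S : MultiHostState X) (cyl : CylState S)
      [IsIntegral cyl.Z] [IsNoetherian cyl.Z] (_hZ : Scheme.IsRegular cyl.Z)
      (_hPcyl : P S cyl)
      (𝓑 : List cyl.Z.IdealSheafData) (_hlink : ∀ T ∈ S.𝓔, T ≠ cyl.j.ker → cyl.bd T ∈ 𝓑) (_hsnc𝓑 : HasSNC 𝓑)
      (_hirr𝓑 : ∀ T ∈ 𝓑, IsPreirreducible (T.support : Set cyl.Z))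
      {C₀ : cyl.Z.IdealSheafData} (_hC₀ : Scheme.IsRegular C₀.subscheme)
      {Zs : List (Closeds cyl.Z)} (_hlen : Zs.length = n) (_hP : IsPiecePartition C₀ Zs)
      (_hΓ : ∀ Z ∈ Zs, IsIrreducible (Z : Set cyl.Z) ∧ Scheme.IsRegular (vanishingIdeal Z).subscheme ∧
        (∃ i, (Z : Set cyl.Z) ⊆ (cyl.tr i).support) ∧ HasSNCWith 𝓑 (vanishingIdeal Z))
      {B₀ : Set cyl.Z} (_h𝓑B : ∀ T ∈ 𝓑, (T.support : Set cyl.Z) ⊆ B₀) (_hCB : (C₀.support : Set cyl.Z) ⊆ B₀)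
      (_hcov : ∀ x ∈ B₀, (∃ T ∈ 𝓑, x ∈ T.support) ∨ x ∈ (C₀.support : Set cyl.Z))
      {E'' : Scheme.{u}} {τE : E'' ⟶ cyl.Z} (_hτE : IsBlowup τE C₀),
      ∃ (X' : Scheme.{u}) (π : X' ⟶ X) (_ : IsNoetherian X') (S' : MultiHostState X') (cyl' : CylState S')
        (ρ : cyl'.Z ⟶ cyl.Z) (_ : IsIntegral cyl'.Z) (_ : IsNoetherian cyl'.Z) (e : cyl'.Z ≅ E'')
        (𝓑' : List cyl'.Z.IdealSheafData),
        P S' cyl' ∧ (∃ Q : X.IdealSheafData, IsBlowup π Q ∧ (Q.support : Set X) ⊆ Set.range cyl.j) ∧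
        Scheme.IsRegular X' ∧ S'.K = S.K.comap π ∧ S'.n = S.n ∧ cyl'.j ≫ π = ρ ≫ cyl.j ∧ e.hom ≫ τE = ρ ∧
        Scheme.IsRegular cyl'.Z ∧
        (∀ T ∈ S'.𝓔, T ≠ cyl'.j.ker → cyl'.bd T ∈ 𝓑') ∧ HasSNC 𝓑' ∧
        (∀ T' ∈ 𝓑', IsPreirreducible (T'.support : Set cyl'.Z)) ∧
        (∀ i, ρ ⁻¹' (((cyl.tr i).support : Set cyl.Z) \ (C₀.support : Set cyl.Z)) ⊆ ⋃ i', ((cyl'.tr i').support : Set cyl'.Z)) ∧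
        (∀ i', ((cyl'.tr i').support : Set cyl'.Z) ⊆ ρ ⁻¹' ⋃ i, ((cyl.tr i).support : Set cyl.Z)) ∧
        (∀ T' ∈ 𝓑', (T'.support : Set cyl'.Z) ⊆ ρ ⁻¹' B₀) ∧
        (∀ x' : cyl'.Z, ρ x' ∈ B₀ → ∃ T' ∈ 𝓑', x' ∈ T'.support) := by
  induction n with
  | zero =>
    intro X _ hX S cyl _ _ hZ hPcyl 𝓑 hlink hsnc𝓑 hirr𝓑 C₀ hC₀ Zs hlen hPart hΓ B₀ h𝓑B hCB hcov E'' τE hτE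
    -- no piece: `C₀ = ⊤`, `τE` is an isomorphism
    have hZs : Zs = [] := List.eq_nil_of_length_eq_zero hlen
    subst hZs
    have hC₀top : C₀ = ⊤ := by
      rw [← prod_pieceIdeals_eq_of_isRegular hC₀ hPart]
      simp [pieceIdeals, Scheme.IdealSheafData.one_eq_top]
    haveI := isIso_of_isBlowup_top hτE hC₀top
    have hC₀s : (C₀.support : Set cyl.Z) = ∅ := by
      rw [hC₀top, Scheme.IdealSheafData.support_top]; rfl
    refine ⟨X, 𝟙 X, inferInstance, S, cyl, 𝟙 cyl.Z, inferInstance, inferInstance, (asIso τE).symm, 𝓑, hPcyl,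
      ⟨⊤, isBlowup_id_top X, by rw [Scheme.IdealSheafData.support_top]; exact fun x hx => absurd hx id⟩, hX,
      by rw [Scheme.IdealSheafData.comap_id], rfl, by rw [Category.comp_id, Category.id_comp],
      by rw [Iso.symm_hom, asIso_inv, IsIso.inv_hom_id], hZ, hlink, hsnc𝓑, hirr𝓑, fun i x hx => ?_, fun i' x hx => ?_,
      fun T hT x hx => by simpa using h𝓑B T hT hx, fun x hx => ?_⟩
    · exact Set.mem_iUnion.mpr ⟨i, hx.1⟩
    · exact Set.mem_iUnion.mpr ⟨i', hx⟩
    · rcases hcov x hx with h | h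
      · exact h
      · rw [hC₀s] at h; exact absurd h id
  | succ n ih =>
    intro X _ hX S cyl _ _ hZ hPcyl 𝓑 hlink hsnc𝓑 hirr𝓑 C₀ hC₀ Zs hlen hPart hΓ B₀ h𝓑B hCB hcov E'' τE hτE
    obtain ⟨Z, Zs', rfl⟩ : ∃ Z Zs', Zs = Z :: Zs' := by
      cases Zs with
      | nil => exact absurd hlen (by simp)
      | cons Z Zs' => exact ⟨Z, Zs', rfl⟩
    have hlen' : Zs'.length = n := by simpa using hlen
    have hZC : (Z : Set cyl.Z) ⊆ (C₀.support : Set cyl.Z) := hPart.subset List.mem_cons_self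
    have hZB : (Z : Set cyl.Z) ⊆ B₀ := hZC.trans hCB
    obtain ⟨hirr, hZreg, ⟨i₀, hZi₀⟩, hsncZ⟩ := hΓ Z List.mem_cons_self
    -- FIRST PIECE: the joint piece step
    obtain ⟨X₁, τ₁, hnoethX₁, S₁, cyl₁, τZ, hint₁, hnoeth₁, hP₁, hτ₁, hW₁reg, hW₁j, hX₁, hK₁, hn₁, hτZ, hj₁, hZ₁reg, -, hlink₁,
      hsnc₁, hirr₁, hlow₁, hup₁, hbd₁, hcov₁⟩ :=
      joint_piece_P hlift P hP hX S cyl hPcyl hZ 𝓑 hlink hsnc𝓑 hirr𝓑 Z hirr hZreg hZi₀ hsncZ h𝓑B hZB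
    haveI := hnoethX₁
    haveI := hint₁
    haveI := hnoeth₁
    -- the CJS blowing up follows through `τZ`
    obtain ⟨τ₂, hcomp, hτ₂, hC₁reg, hPart₁⟩ := exists_fac_of_isPiecePartition_cons hC₀ hPart hτE hτZ
    -- the data of the remaining pieces, transported
    set 𝓑₁ : List cyl₁.Z.IdealSheafData :=
      𝓑.map (strictTransformIdeal τZ (vanishingIdeal Z)) ++ [(vanishingIdeal Z).comap τZ] with h𝓑₁
    have hΓ₁ : ∀ Z₁ ∈ Zs'.map (fun W : Closeds cyl.Z => W.preimage τZ.continuous),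
        IsIrreducible (Z₁ : Set cyl₁.Z) ∧ Scheme.IsRegular (vanishingIdeal Z₁).subscheme ∧
          (∃ i, (Z₁ : Set cyl₁.Z) ⊆ (cyl₁.tr i).support) ∧ HasSNCWith 𝓑₁ (vanishingIdeal Z₁) := by
      intro Z₁ hZ₁
      obtain ⟨Z₂, hZ₂, rfl⟩ := List.mem_map.mp hZ₁
      obtain ⟨hirr₂, hZ₂reg, ⟨i₂, hZ₂i⟩, hsnc₂⟩ := hΓ Z₂ (List.mem_cons_of_mem _ hZ₂)
      have hd : Disjoint (Z : Set cyl.Z) Z₂ := hPart.disjoint_of_mem_tail hZ₂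
      obtain ⟨hirr₂', hZ₂reg', hsnc₂'⟩ := piece_data_transport hsncZ hτZ hirr₂ hZ₂reg hsnc₂ hd
      refine ⟨hirr₂', hZ₂reg', ?_, hsnc₂'⟩
      -- `τZ⁻¹ Z₂ ⊆ τZ⁻¹(Supp tr i₂ ∖ Z) ⊆ ⋃ Supp tr′`, and irreducible ⇒ inside ONE host
      refine exists_subset_support_of_subset_iUnion cyl₁.tr hirr₂' fun x hx => hlow₁ i₂ ⟨hZ₂i hx, ?_⟩
      exact Set.disjoint_right.mp hd hx
    have hlen₁ : (Zs'.map (fun W : Closeds cyl.Z => W.preimage τZ.continuous)).length = n := by simpa using hlen'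
    -- the remaining centre lies over `⋃ Zs' ⊆ V(C₀) ⊆ B₀`
    set T : Set cyl.Z := ⋃ Z₂ ∈ Zs', (Z₂ : Set cyl.Z) with hT
    have hC₁supp : (((pieceIdeals (Zs'.map fun W : Closeds cyl.Z => W.preimage τZ.continuous)).prod).support : Set cyl₁.Z) =
        τZ ⁻¹' T := by
      rw [← hPart₁.2, hT]
      ext x
      simp only [List.mem_map, Set.mem_iUnion, exists_prop, Set.mem_preimage]
      constructor
      · rintro ⟨_, ⟨Z₂, hZ₂, rfl⟩, hx⟩
        exact ⟨Z₂, hZ₂, hx⟩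
      · rintro ⟨Z₂, hZ₂, hx⟩
        exact ⟨_, ⟨Z₂, hZ₂, rfl⟩, hx⟩
    have hTC : T ⊆ (C₀.support : Set cyl.Z) := by
      rw [← hPart.2, hT]
      exact Set.iUnion₂_subset fun Z₂ hZ₂ =>
        Set.subset_iUnion₂ (s := fun (Z' : Closeds cyl.Z) (_ : Z' ∈ Z :: Zs') => (Z' : Set cyl.Z)) Z₂ (List.mem_cons_of_mem _ hZ₂)
    have hZT : (Z : Set cyl.Z) ∪ T = (C₀.support : Set cyl.Z) := by
      rw [← hPart.2, hT]
      ext x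
      simp only [Set.mem_union, Set.mem_iUnion, List.mem_cons, exists_prop]
      constructor
      · rintro (hx | ⟨Z₂, hZ₂, hx⟩)
        · exact ⟨Z, Or.inl rfl, hx⟩
        · exact ⟨Z₂, Or.inr hZ₂, hx⟩
      · rintro ⟨Z', rfl | hZ', hx⟩
        · exact Or.inl hx
        · exact Or.inr ⟨Z', hZ', hx⟩
    have hCB₁ : (((pieceIdeals (Zs'.map fun W : Closeds cyl.Z => W.preimage τZ.continuous)).prod).support : Set cyl₁.Z) ⊆
        τZ ⁻¹' B₀ := by
      rw [hC₁supp]; exact Set.preimage_mono (hTC.trans hCB)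
    have hcov₁' : ∀ x₁ ∈ τZ ⁻¹' B₀, (∃ T' ∈ 𝓑₁, x₁ ∈ T'.support) ∨
        x₁ ∈ ((((pieceIdeals (Zs'.map fun W : Closeds cyl.Z => W.preimage τZ.continuous)).prod).support : Set cyl₁.Z)) := by
      intro x₁ hx₁
      rcases hcov (τZ x₁) hx₁ with h | h
      · exact Or.inl (hcov₁ x₁ (Or.inl h))
      · rw [← hZT] at h
        rcases h with h | h
        · exact Or.inl (hcov₁ x₁ (Or.inr h))
        · right; rw [hC₁supp]; exact h
    -- RECURSION on the remaining pieces
    obtain ⟨X', π', hnoethX', S', cyl', ρ', hint', hnoeth', e', 𝓑', hP', ⟨Q', hQ', hQ's⟩, hX', hK', hn', hj', he', hZ'reg,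
      hlink', hsnc', hirr', hlow', hup', hbd', hcov'⟩ :=
      ih hX₁ S₁ cyl₁ hZ₁reg hP₁ 𝓑₁ hlink₁ hsnc₁ hirr₁ hC₁reg hlen₁ hPart₁ hΓ₁ hbd₁ hCB₁ hcov₁' hτ₂
    haveI := hnoethX'
    haveI := hint'
    haveI := hnoeth'
    have hρx : ∀ x' : cyl'.Z, (ρ' ≫ τZ) x' = τZ (ρ' x') := fun x' => by
      simp only [Scheme.Hom.comp_base, TopCat.coe_comp, Function.comp_apply]
    refine ⟨X', π' ≫ τ₁, hnoethX', S', cyl', ρ' ≫ τZ, hint', hnoeth', e', 𝓑', hP', ?_, hX', ?_, hn'.trans hn₁, ?_, ?_, hZ'reg,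
      hlink',
      hsnc', hirr', fun i x' hx' => ?_, fun i' x' hx' => ?_, fun T' hT' x' hx' => ?_, fun x' hx' => hcov' x' ?_⟩
    · -- the tower: one blowing up supported on the carrier (Stacks 080B)
      obtain ⟨Q, hQ, hQs⟩ := IsBlowup.exists_isBlowup_comp_supported τ₁ (vanishingIdeal (cyl.centre (vanishingIdeal Z))) π' Q'
        (Set.range cyl.j) hτ₁ (by rw [Scheme.IdealSheafData.coe_support_vanishingIdeal]; exact hW₁j) hQ'
        (hQ's.trans (by
          rintro x ⟨z, rfl⟩
          change τ₁ (cyl₁.j z) ∈ Set.range cyl.j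
          rw [← Scheme.Hom.comp_apply, hj₁, Scheme.Hom.comp_apply]
          exact ⟨τZ z, rfl⟩))
      exact ⟨Q, hQ, hQs⟩
    · rw [hK', hK₁, ← Scheme.IdealSheafData.comap_comp]
    · rw [← Category.assoc, hj', Category.assoc, hj₁, Category.assoc]
    · rw [← hcomp, ← Category.assoc, he']
    · -- lower bound through the two stages
      rw [Set.mem_preimage, hρx] at hx'
      have hxC : τZ (ρ' x') ∉ (C₀.support : Set cyl.Z) := hx'.2
      rw [← hZT, Set.mem_union, not_or] at hxC
      obtain ⟨i₁, hi₁⟩ := Set.mem_iUnion.mp (hlow₁ i ⟨hx'.1, hxC.1⟩)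
      refine hlow' i₁ ⟨hi₁, ?_⟩
      rw [hC₁supp]
      exact hxC.2
    · -- upper bound
      obtain ⟨i₁, hi₁⟩ := Set.mem_iUnion.mp (hup' i' hx')
      rw [Set.mem_preimage, hρx]
      exact hup₁ i₁ hi₁
    · have h1 := hbd' T' hT' hx'
      rw [Set.mem_preimage, hρx]
      exact h1
    · rw [hρx] at hx'
      exact hx'

/-- [OURS · L1 W5.2 · F7(β) T2b-X] **ONE CJS CENTRE, jointly.**  Given the joint state and a regular E-side centre `C₀` on the carrier
with pieces `Zs` (partition; each irreducible, regular, inside a host trace, snc with the boundary traces) and ANY blowing up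
`τE : E″ → Z` along `C₀` (the CJS blowing up read on the carrier): blowing `X` up piece by piece (`joint_piece`) yields `X′ → X` (ONE
blowing up supported on the carrier, `X′` regular, `K′ = π^*K`), a cylinder state on `X′` whose carrier is `≅ E″` over `Z`, the
boundary traces linked / snc / preirreducible, and the host / boundary bounds and cover relative to `ρ : Z′ → Z`.
[cite: CossartJannsenSaito2020, (6.2)] [cite: Kollar2007, (3.111) Steps 1–3] [cite: StacksProject, Tag 080A] -/
theorem joint_centre {X : Scheme.{u}} [IsNoetherian X] (hX : Scheme.IsRegular X) (S : MultiHostState X) (cyl : CylState S)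
    [IsIntegral cyl.Z] [IsNoetherian cyl.Z] (hZ : Scheme.IsRegular cyl.Z) (hPcyl : P S cyl)
    (𝓑 : List cyl.Z.IdealSheafData) (hlink : ∀ T ∈ S.𝓔, T ≠ cyl.j.ker → cyl.bd T ∈ 𝓑) (hsnc𝓑 : HasSNC 𝓑)
    (hirr𝓑 : ∀ T ∈ 𝓑, IsPreirreducible (T.support : Set cyl.Z))
    {C₀ : cyl.Z.IdealSheafData} (hC₀ : Scheme.IsRegular C₀.subscheme)
    {Zs : List (Closeds cyl.Z)} (hPart : IsPiecePartition C₀ Zs)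
    (hΓ : ∀ Z ∈ Zs, IsIrreducible (Z : Set cyl.Z) ∧ Scheme.IsRegular (vanishingIdeal Z).subscheme ∧
      (∃ i, (Z : Set cyl.Z) ⊆ (cyl.tr i).support) ∧ HasSNCWith 𝓑 (vanishingIdeal Z))
    {B₀ : Set cyl.Z} (h𝓑B : ∀ T ∈ 𝓑, (T.support : Set cyl.Z) ⊆ B₀) (hCB : (C₀.support : Set cyl.Z) ⊆ B₀)
    (hcov : ∀ x ∈ B₀, (∃ T ∈ 𝓑, x ∈ T.support) ∨ x ∈ (C₀.support : Set cyl.Z))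
    {E'' : Scheme.{u}} {τE : E'' ⟶ cyl.Z} (hτE : IsBlowup τE C₀) :
    ∃ (X' : Scheme.{u}) (π : X' ⟶ X) (_ : IsNoetherian X') (S' : MultiHostState X') (cyl' : CylState S')
      (ρ : cyl'.Z ⟶ cyl.Z) (_ : IsIntegral cyl'.Z) (_ : IsNoetherian cyl'.Z) (e : cyl'.Z ≅ E'')
      (𝓑' : List cyl'.Z.IdealSheafData),
      P S' cyl' ∧ (∃ Q : X.IdealSheafData, IsBlowup π Q ∧ (Q.support : Set X) ⊆ Set.range cyl.j) ∧
      Scheme.IsRegular X' ∧ S'.K = S.K.comap π ∧ S'.n = S.n ∧ cyl'.j ≫ π = ρ ≫ cyl.j ∧ e.hom ≫ τE = ρ ∧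
      Scheme.IsRegular cyl'.Z ∧
      (∀ T ∈ S'.𝓔, T ≠ cyl'.j.ker → cyl'.bd T ∈ 𝓑') ∧ HasSNC 𝓑' ∧
      (∀ T' ∈ 𝓑', IsPreirreducible (T'.support : Set cyl'.Z)) ∧
      (∀ i, ρ ⁻¹' (((cyl.tr i).support : Set cyl.Z) \ (C₀.support : Set cyl.Z)) ⊆ ⋃ i', ((cyl'.tr i').support : Set cyl'.Z)) ∧
      (∀ i', ((cyl'.tr i').support : Set cyl'.Z) ⊆ ρ ⁻¹' ⋃ i, ((cyl.tr i).support : Set cyl.Z)) ∧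
      (∀ T' ∈ 𝓑', (T'.support : Set cyl'.Z) ⊆ ρ ⁻¹' B₀) ∧
      (∀ x' : cyl'.Z, ρ x' ∈ B₀ → ∃ T' ∈ 𝓑', x' ∈ T'.support) :=
  joint_centre_aux hlift P hP Zs.length hX S cyl hZ hPcyl 𝓑 hlink hsnc𝓑 hirr𝓑 hC₀ rfl hPart hΓ h𝓑B hCB hcov hτE

end Loop

end MultiHostCJS

end Summit.ResolutionOfSingularities.ResolutionOfSingularities.Theorems

end
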